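import Mathlib.MeasureTheory.Function.Jacobian
import Mathlib.Analysis.Calculus.InverseFunctionTheorem.FDeriv
import Mathlib.Analysis.Calculus.ContDiff.Comp
import Mathlib.MeasureTheory.Integral.Bochner.ContinuousLinearMap
import HarnessLib

/-!
# Reparametrising a Haar chart: a chart of a group carrying Haar measure with a continuous density, composed with a local
# diffeomorphism of `ℝ^d` at `0`, is again such a chart, with density `|det Dκ| · (w ∘ κ)`
# (the change-of-variables half of [Helgason2000] Ch. I §1 Thm. 1.14 (13), in the coordinates one actually meets)

Topic `MeasureTheory/Group`; namespace `Literature.MeasureTheory.Group.HaarChartReparam`.  THEOREMS ONLY (no definition, no named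
fact, no instance, no `sorry`).  Cell `hodgecm-mathlib`, F0∕P3, road «DM∞» (archimedean Dixmier–Malliavin, weak form, for
`U(H)(L⁺ ⊗ ℝ)`), brick B6 (generic half): the Cayley chart of `U(H)(L⁺ ⊗ ℝ)` carries Haar measure with a continuous density (brick B5b);
the one-parameter steps of Dixmier–Malliavin produce integrals over the coordinates of the SECOND kind `s ↦ e^{s₀X₀}⋯e^{s_{d−1}X_{d−1}}`
(bricks B4, B6a), which near `0` are the Cayley chart composed with a local diffeomorphism `κ` of `ℝ^d`.  This file moves the density
across `κ` and turns the chart identity into the integral identity the road consumes.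

THE RESULTS.  `G` a Hausdorff topological space with a Borel measure `μ` (a group plays no role here); `ℝ^d := Fin d → ℝ` (sup norm, Lebesgue
measure `volume`).
* §1 `restrict_image_eq_map_of_subset` — a chart identity `μ|_{e.target} = e_*(ρ · ν|_{e.source})` restricts to every open
  `S ⊆ e.source`: `μ|_{e(S)} = e_*(ρ · ν|_S)`.
* §2 `exists_chart_comp` — `e : OpenPartialHomeomorph ℝ^d G` with `μ|_{e.target} = e_*( w · vol|_{e.source} )`, `w` continuous `> 0` on
  `e.source`; `κ : ℝ^d → ℝ^d` with `κ 0 ∈ e.source`, an invertible STRICT derivative at `0`, `C¹` near `0`.  Then for some `δ > 0`, on the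
  cube `C = ball 0 δ`: `Ψ := e ∘ κ` is injective and continuous with a continuous inverse `σ` on the open set `U := Ψ(C) ⊆ e.target`, and
  `μ|_U = Ψ_*( J · vol|_C )`, `J(s) = |det Dκ(s)| · w(κ s)` continuous `> 0` on `C` (inverse function theorem; Mathlib's change of variables
  `lintegral_image_eq_lintegral_abs_det_fderiv_mul`; equality of measures on measurable sets).
* §3 `exists_integral_eq_integral_mul` — from such a chart identity: for every continuous `k : ℝ^d → ℂ` with compact support inside `C`
  there is `a ∈ C_c(G, ℂ)` (namely `(k/J) ∘ σ` on `U`, `0` off `U`) with `∫ k(s) F(Ψ s) ds = ∫ a F dμ` for every continuous `F : G → ℂ`.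

HONEST SCOPE.  Pure measure theory + calculus on `ℝ^d` (Mathlib only); no Lie theory; the chart `e` and its density are INPUTS (brick
B5b for the Cayley chart of `U(H)(L⁺ ⊗ ℝ)`).  HC_CM is proved only modulo the printed citations until rung 0 closes; this file discharges
no printed statement of the programme.

## References
* S. Helgason, *Groups and Geometric Analysis*, AMS Math. Surveys Monogr. 83 (2000), Ch. I §1, Theorem 1.14 (13), p. 96. [Helgason2000]
* A. W. Knapp, *Lie Groups Beyond an Introduction*, 2nd ed. (2002), I §10 (canonical coordinates of the second kind), VIII §2
  (Haar measure in coordinates, (8.24)). [Knapp2002]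
-/

noncomputable section

open MeasureTheory MeasureTheory.Measure Set Function Filter Topology
open scoped ENNReal NNReal Topology

namespace Literature.MeasureTheory.Group.HaarChartReparam

variable {G : Type*} [TopologicalSpace G] [MeasurableSpace G] [BorelSpace G] {d : ℕ}

/-! ## §1 Plumbing: measurability through a chart, the chart measure on a sub-window -/

/-- Preimages under a function continuous on a measurable set `S` are measurable inside `S`. [folklore] -/
private theorem measurableSet_preimage_inter {X : Type*} [TopologicalSpace X] [MeasurableSpace X] [BorelSpace X]
    {f : X → G} {S : Set X} (hf : ContinuousOn f S) (hS : MeasurableSet S) {A : Set G} (hA : MeasurableSet A) :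
    MeasurableSet (f ⁻¹' A ∩ S) := by
  have hc : Continuous (S.restrict f) := continuousOn_iff_continuous_restrict.mp hf
  have hm : MeasurableSet ((S.restrict f) ⁻¹' A) := hc.measurable hA
  have heq : f ⁻¹' A ∩ S = Subtype.val '' ((S.restrict f) ⁻¹' A) := by
    ext x
    constructor
    · rintro ⟨hx, hxS⟩
      exact ⟨⟨x, hxS⟩, hx, rfl⟩
    · rintro ⟨⟨y, hyS⟩, hy, rfl⟩
      exact ⟨hy, hyS⟩
  rw [heq]
  exact MeasurableSet.subtype_image hS hm

/-- A chart function is a.e.-measurable for every measure with density carried by (a measurable subset of) its source. [folklore] -/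
private theorem aemeasurable_withDensity_of_continuousOn {X : Type*} [TopologicalSpace X] [MeasurableSpace X] [BorelSpace X]
    {f : X → G} {S : Set X} (hf : ContinuousOn f S) (hS : MeasurableSet S) (ν : Measure X) (ρ : X → ℝ≥0∞) :
    AEMeasurable f ((ν.restrict S).withDensity ρ) :=
  (hf.aemeasurable hS).mono_ac (withDensity_absolutelyContinuous _ _)

omit [TopologicalSpace G] [MeasurableSpace G] [BorelSpace G] in
/-- The chart measure of a set: `(ρ · ν|_S)(f⁻¹ A) = ∫_{f⁻¹A ∩ S} ρ dν`. [folklore] -/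
private theorem withDensity_restrict_preimage {X : Type*} [MeasurableSpace X] (ν : Measure X) [SFinite ν] (ρ : X → ℝ≥0∞)
    {S : Set X} (hS : MeasurableSet S) (f : X → G) (A : Set G) :
    ((ν.restrict S).withDensity ρ) (f ⁻¹' A) = ∫⁻ x in f ⁻¹' A ∩ S, ρ x ∂ν := by
  rw [withDensity_apply' _ (f ⁻¹' A), Measure.restrict_restrict' hS]

/-- **Restriction of a chart identity to a sub-window.**  If `μ|_{e.target} = e_*(ρ · ν|_{e.source})` and `S ⊆ e.source` is open, then
`μ|_{e(S)} = e_*(ρ · ν|_S)`. [cite: Helgason2000, Ch. I §1 Thm. 1.14 (13) p. 96] -/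
theorem restrict_image_eq_map_of_subset {X : Type*} [TopologicalSpace X] [MeasurableSpace X] [BorelSpace X]
    (μ : Measure G) (ν : Measure X) [SFinite ν] (e : OpenPartialHomeomorph X G) (ρ : X → ℝ≥0∞)
    (hμ : μ.restrict e.target = Measure.map e ((ν.restrict e.source).withDensity ρ))
    {S : Set X} (hSe : S ⊆ e.source) (hSo : IsOpen S) :
    μ.restrict (e '' S) = Measure.map e ((ν.restrict S).withDensity ρ) := by
  have hS : MeasurableSet S := hSo.measurableSet
  have heS : IsOpen (e '' S) := e.isOpen_image_of_subset_source hSo hSe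
  have heSm : MeasurableSet (e '' S) := heS.measurableSet
  have hsub : e '' S ⊆ e.target := (image_mono hSe).trans e.image_source_subset
  have hae₁ : AEMeasurable e ((ν.restrict e.source).withDensity ρ) :=
    aemeasurable_withDensity_of_continuousOn e.continuousOn e.open_source.measurableSet ν ρ
  have hae₂ : AEMeasurable e ((ν.restrict S).withDensity ρ) :=
    aemeasurable_withDensity_of_continuousOn (e.continuousOn.mono hSe) hS ν ρ
  ext A hA
  rw [Measure.restrict_apply hA, Measure.map_apply_of_aemeasurable hae₂ hA]
  have h1 : μ (A ∩ e '' S) = (μ.restrict e.target) (A ∩ e '' S) := by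
    rw [Measure.restrict_apply (hA.inter heSm), inter_assoc, inter_eq_left.mpr hsub]
  have hset : (e : X → G) ⁻¹' (A ∩ e '' S) ∩ e.source = (e : X → G) ⁻¹' A ∩ S := by
    ext x
    rw [mem_inter_iff, mem_preimage, mem_inter_iff, mem_inter_iff, mem_preimage, mem_image]
    constructor
    · rintro ⟨⟨hxA, y, hyS, hyx⟩, hxs⟩
      have : y = x := e.injOn (hSe hyS) hxs hyx
      subst this
      exact ⟨hxA, hyS⟩
    · rintro ⟨hxA, hxS⟩
      exact ⟨⟨hxA, x, hxS, rfl⟩, hSe hxS⟩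
  rw [h1, hμ, Measure.map_apply_of_aemeasurable hae₁ (hA.inter heSm),
    withDensity_restrict_preimage ν ρ e.open_source.measurableSet, withDensity_restrict_preimage ν ρ hS, hset]



omit [TopologicalSpace G] [BorelSpace G] in
/-- **Transport of a chart measure along a homeomorphism of parameter spaces** (reading a chart on `X` through `φ : Y ≃ₜ X`, e.g. a
basis isomorphism `ℝ^d ≃ 𝔤`): `(f ∘ φ)_*((ρ ∘ φ) · ν'|_{φ⁻¹S}) = f_*(ρ · (φ_*ν')|_S)`. [cite: Helgason2000, Ch. I §1 Thm. 1.14 (13) p. 96] -/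
theorem map_comp_homeomorph_withDensity {X Y : Type*} [TopologicalSpace X] [MeasurableSpace X] [BorelSpace X]
    [TopologicalSpace Y] [MeasurableSpace Y] [BorelSpace Y]
    (ν' : Measure Y) (φ : Y ≃ₜ X) (f : X → G) (S : Set X) (ρ : X → ℝ≥0∞)
    (hf : AEMeasurable f (((Measure.map φ ν').restrict S).withDensity ρ)) :
    Measure.map (f ∘ φ) ((ν'.restrict (φ ⁻¹' S)).withDensity (ρ ∘ φ)) =
      Measure.map f (((Measure.map φ ν').restrict S).withDensity ρ) := by
  set ψ : Y ≃ᵐ X := φ.toMeasurableEquiv with hψ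
  have hψφ : (ψ : Y → X) = φ := rfl
  have key : ((Measure.map φ ν').restrict S).withDensity ρ = Measure.map φ ((ν'.restrict (φ ⁻¹' S)).withDensity (ρ ∘ φ)) := by
    ext A hA
    rw [withDensity_apply _ hA, Measure.restrict_restrict hA, ← hψφ, MeasurableEquiv.restrict_map, lintegral_map_equiv,
      MeasurableEquiv.map_apply, withDensity_apply _ (ψ.measurable hA), Measure.restrict_restrict (ψ.measurable hA),
      preimage_inter]
    rfl
  rw [key]
  have hf' : AEMeasurable f (Measure.map φ ((ν'.restrict (φ ⁻¹' S)).withDensity (ρ ∘ φ))) := by rwa [← key]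
  exact (AEMeasurable.map_map_of_aemeasurable hf' φ.continuous.measurable.aemeasurable).symm

/-! ## §2 Composing a chart with a local diffeomorphism of `ℝ^d` -/

section Comp

variable (μ : Measure G) (e : OpenPartialHomeomorph (Fin d → ℝ) G)

/-- **Reparametrised Haar chart.**  If `μ|_{e.target} = e_*(w · vol|_{e.source})` with `w` continuous `> 0` on `e.source`, and
`κ : ℝ^d → ℝ^d` has `κ 0 ∈ e.source`, an invertible strict derivative at `0` and is `C¹` near `0`, then for some `δ > 0`, on `C = ball 0 δ`:
`Ψ = e ∘ κ` is injective and continuous with a continuous inverse `σ` on the open set `Ψ(C) ⊆ e.target`, the density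
`J = |det Dκ| · (w ∘ κ)` is continuous `> 0` on `C`, and `μ|_{Ψ(C)} = Ψ_*(J · vol|_C)`.
[cite: Helgason2000, Ch. I §1 Thm. 1.14 (13) p. 96] [cite: Knapp2002, VIII §2 (8.24)] -/
theorem exists_chart_comp {w : (Fin d → ℝ) → ℝ} (hw : ContinuousOn w e.source) (hw0 : ∀ y ∈ e.source, 0 < w y)
    (hμ : μ.restrict e.target = Measure.map e ((volume.restrict e.source).withDensity fun y => ENNReal.ofReal (w y)))
    {κ : (Fin d → ℝ) → (Fin d → ℝ)} {κ' : (Fin d → ℝ) ≃L[ℝ] (Fin d → ℝ)} (hκ0 : κ 0 ∈ e.source)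
    (hκd : HasStrictFDerivAt κ (κ' : (Fin d → ℝ) →L[ℝ] (Fin d → ℝ)) 0) (hκs : ∀ᶠ s in 𝓝 0, ContDiffAt ℝ 1 κ s) :
    ∃ δ : ℝ, 0 < δ ∧
      ContinuousOn κ (Metric.ball 0 δ) ∧ Set.InjOn κ (Metric.ball 0 δ) ∧ κ '' Metric.ball 0 δ ⊆ e.source ∧
      ContinuousOn (e ∘ κ) (Metric.ball 0 δ) ∧ Set.InjOn (e ∘ κ) (Metric.ball 0 δ) ∧
      IsOpen ((e ∘ κ) '' Metric.ball 0 δ) ∧ (e ∘ κ) '' Metric.ball 0 δ ⊆ e.target ∧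
      (∃ σ : G → (Fin d → ℝ), ContinuousOn σ ((e ∘ κ) '' Metric.ball 0 δ) ∧ ∀ s ∈ Metric.ball 0 δ, σ (e (κ s)) = s) ∧
      ContinuousOn (fun s => |(fderiv ℝ κ s).det| * w (κ s)) (Metric.ball 0 δ) ∧
      (∀ s ∈ Metric.ball 0 δ, 0 < |(fderiv ℝ κ s).det| * w (κ s)) ∧
      μ.restrict ((e ∘ κ) '' Metric.ball 0 δ) =
        Measure.map (e ∘ κ) ((volume.restrict (Metric.ball 0 δ)).withDensity
          fun s => ENNReal.ofReal (|(fderiv ℝ κ s).det| * w (κ s))) := by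
  -- the inverse function theorem
  set P := hκd.toOpenPartialHomeomorph κ with hP_def
  have hP0 : (0 : Fin d → ℝ) ∈ P.source := hκd.mem_toOpenPartialHomeomorph_source
  have hPκ : (P : (Fin d → ℝ) → (Fin d → ℝ)) = κ := hκd.toOpenPartialHomeomorph_coe
  -- the neighbourhood of `0` on which everything holds
  have n1 : P.source ∈ 𝓝 (0 : Fin d → ℝ) := P.open_source.mem_nhds hP0
  have n2 : κ ⁻¹' e.source ∈ 𝓝 (0 : Fin d → ℝ) := hκd.continuousAt.preimage_mem_nhds (e.open_source.mem_nhds hκ0)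
  have n3 : {s | ContDiffAt ℝ 1 κ s} ∈ 𝓝 (0 : Fin d → ℝ) := hκs
  have hdet0 : (fderiv ℝ κ 0).det ≠ 0 := by
    rw [hκd.hasFDerivAt.fderiv]
    exact (LinearEquiv.isUnit_det' κ'.toLinearEquiv).ne_zero
  have hcont_fderiv0 : ContinuousAt (fun s => (fderiv ℝ κ s).det) 0 :=
    ContinuousLinearMap.continuous_det.continuousAt.comp (hκs.self_of_nhds.continuousAt_fderiv one_ne_zero)
  have n4 : {s | (fderiv ℝ κ s).det ≠ 0} ∈ 𝓝 (0 : Fin d → ℝ) :=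
    hcont_fderiv0.preimage_mem_nhds (isOpen_ne.mem_nhds hdet0)
  obtain ⟨δ, hδ, hball⟩ := Metric.mem_nhds_iff.mp (Filter.inter_mem (Filter.inter_mem (Filter.inter_mem n1 n2) n3) n4)
  set C : Set (Fin d → ℝ) := Metric.ball 0 δ with hC
  have hCP : C ⊆ P.source := fun s hs => (hball hs).1.1.1
  have hCe : ∀ s ∈ C, κ s ∈ e.source := fun s hs => (hball hs).1.1.2
  have hC1 : ∀ s ∈ C, ContDiffAt ℝ 1 κ s := fun s hs => (hball hs).1.2
  have hCdet : ∀ s ∈ C, (fderiv ℝ κ s).det ≠ 0 := fun s hs => (hball hs).2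
  have hCo : IsOpen C := Metric.isOpen_ball
  -- `κ` on `C`
  have hκc : ContinuousOn κ C := fun s hs => (hC1 s hs).continuousAt.continuousWithinAt
  have hκi : Set.InjOn κ C := by
    have := P.injOn.mono hCP
    rwa [hPκ] at this
  have hκC : κ '' C ⊆ e.source := by
    rintro _ ⟨s, hs, rfl⟩; exact hCe s hs
  have hκCo : IsOpen (κ '' C) := by
    have := P.isOpen_image_of_subset_source hCo hCP
    rwa [hPκ] at this
  -- `Ψ = e ∘ κ` on `C`
  have hΨc : ContinuousOn (e ∘ κ) C := e.continuousOn.comp hκc fun s hs => hCe s hs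
  have hΨi : Set.InjOn (e ∘ κ) C := e.injOn.comp hκi fun s hs => hCe s hs
  have hU : (e ∘ κ) '' C = e '' (κ '' C) := (image_comp e κ C)
  have hUo : IsOpen ((e ∘ κ) '' C) := by
    rw [hU]; exact e.isOpen_image_of_subset_source hκCo hκC
  have hUt : (e ∘ κ) '' C ⊆ e.target := by
    rw [hU]; exact (image_mono hκC).trans e.image_source_subset
  -- the inverse `σ = P⁻¹ ∘ e⁻¹`
  have hσ : ∃ σ : G → (Fin d → ℝ), ContinuousOn σ ((e ∘ κ) '' C) ∧ ∀ s ∈ C, σ (e (κ s)) = s := by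
    refine ⟨fun u => P.symm (e.symm u), ?_, fun s hs => ?_⟩
    · rw [hU]
      refine P.continuousOn_symm.comp (e.continuousOn_symm.mono ((image_mono hκC).trans e.image_source_subset)) ?_
      rintro _ ⟨y, ⟨s, hs, rfl⟩, rfl⟩
      rw [e.left_inv (hCe s hs), ← hPκ]
      exact P.map_source (hCP hs)
    · show P.symm (e.symm (e (κ s))) = s
      rw [e.left_inv (hCe s hs), ← hPκ, P.left_inv (hCP hs)]
  -- the density
  have hJc : ContinuousOn (fun s => |(fderiv ℝ κ s).det| * w (κ s)) C := by
    refine ContinuousOn.mul ?_ (hw.comp hκc fun s hs => hCe s hs)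
    refine (continuousOn_of_forall_continuousAt fun s hs => ?_).abs
    exact ContinuousLinearMap.continuous_det.continuousAt.comp ((hC1 s hs).continuousAt_fderiv one_ne_zero)
  have hJ0 : ∀ s ∈ C, 0 < |(fderiv ℝ κ s).det| * w (κ s) := fun s hs =>
    mul_pos (abs_pos.mpr (hCdet s hs)) (hw0 _ (hCe s hs))
  refine ⟨δ, hδ, hκc, hκi, hκC, hΨc, hΨi, hUo, hUt, hσ, hJc, hJ0, ?_⟩
  -- the measure identity: first restrict the chart identity to the sub-window `κ '' C`
  have h1 := restrict_image_eq_map_of_subset μ volume e (fun y => ENNReal.ofReal (w y)) hμ hκC hκCo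
  rw [hU, h1]
  -- then compare `e_*(w · vol|_{κ C})` with `(e ∘ κ)_*(J · vol|_C)` on measurable sets
  have hderiv : ∀ s ∈ C, HasFDerivWithinAt κ (fderiv ℝ κ s) C s := fun s hs =>
    ((hC1 s hs).differentiableAt one_ne_zero).hasFDerivAt.hasFDerivWithinAt
  have hae₁ : AEMeasurable e ((volume.restrict (κ '' C)).withDensity fun y => ENNReal.ofReal (w y)) :=
    aemeasurable_withDensity_of_continuousOn (e.continuousOn.mono hκC) hκCo.measurableSet _ _
  have hae₂ : AEMeasurable (e ∘ κ) ((volume.restrict C).withDensity fun s => ENNReal.ofReal (|(fderiv ℝ κ s).det| * w (κ s))) :=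
    aemeasurable_withDensity_of_continuousOn hΨc hCo.measurableSet _ _
  ext A hA
  rw [Measure.map_apply_of_aemeasurable hae₁ hA, Measure.map_apply_of_aemeasurable hae₂ hA,
    withDensity_restrict_preimage volume _ hκCo.measurableSet, withDensity_restrict_preimage volume _ hCo.measurableSet]
  -- `∫_{e⁻¹A ∩ κ(C)} w = ∫_{κ(C)} 1_{e⁻¹A} w = ∫_C |det Dκ| (1_{e⁻¹A} w) ∘ κ = ∫_{(e∘κ)⁻¹A ∩ C} |det Dκ| (w ∘ κ)`
  have hmA : MeasurableSet ((e : (Fin d → ℝ) → G) ⁻¹' A ∩ κ '' C) :=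
    measurableSet_preimage_inter (e.continuousOn.mono hκC) hκCo.measurableSet hA
  have hmB : MeasurableSet ((e ∘ κ) ⁻¹' A ∩ C) := measurableSet_preimage_inter hΨc hCo.measurableSet hA
  have step1 : ∫⁻ y in (e : (Fin d → ℝ) → G) ⁻¹' A ∩ κ '' C, ENNReal.ofReal (w y) ∂volume =
      ∫⁻ y in κ '' C, ((e : (Fin d → ℝ) → G) ⁻¹' A ∩ κ '' C).indicator (fun y => ENNReal.ofReal (w y)) y ∂volume := by
    rw [← lintegral_indicator hmA, ← lintegral_indicator hκCo.measurableSet, Set.indicator_indicator,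
      Set.inter_eq_right.mpr inter_subset_right]
  have step2 := lintegral_image_eq_lintegral_abs_det_fderiv_mul volume hCo.measurableSet hderiv hκi
    (((e : (Fin d → ℝ) → G) ⁻¹' A ∩ κ '' C).indicator fun y => ENNReal.ofReal (w y))
  have step3 : ∫⁻ s in C, ENNReal.ofReal |(fderiv ℝ κ s).det| *
        ((e : (Fin d → ℝ) → G) ⁻¹' A ∩ κ '' C).indicator (fun y => ENNReal.ofReal (w y)) (κ s) ∂volume =
      ∫⁻ s in C, ((e ∘ κ) ⁻¹' A ∩ C).indicator (fun s => ENNReal.ofReal (|(fderiv ℝ κ s).det| * w (κ s))) s ∂volume := by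
    refine setLIntegral_congr_fun hCo.measurableSet (fun s hs => ?_)
    by_cases hsA : e (κ s) ∈ A
    · have hin : κ s ∈ (e : (Fin d → ℝ) → G) ⁻¹' A ∩ κ '' C := ⟨hsA, s, hs, rfl⟩
      have hin' : s ∈ (e ∘ κ) ⁻¹' A ∩ C := ⟨hsA, hs⟩
      rw [indicator_of_mem hin, indicator_of_mem hin', ENNReal.ofReal_mul (abs_nonneg _)]
    · have hout : κ s ∉ (e : (Fin d → ℝ) → G) ⁻¹' A ∩ κ '' C := fun h => hsA h.1
      have hout' : s ∉ (e ∘ κ) ⁻¹' A ∩ C := fun h => hsA h.1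
      rw [indicator_of_notMem hout, indicator_of_notMem hout', mul_zero]
  have step4 : ∫⁻ s in C, ((e ∘ κ) ⁻¹' A ∩ C).indicator (fun s => ENNReal.ofReal (|(fderiv ℝ κ s).det| * w (κ s))) s ∂volume =
      ∫⁻ s in (e ∘ κ) ⁻¹' A ∩ C, ENNReal.ofReal (|(fderiv ℝ κ s).det| * w (κ s)) ∂volume := by
    rw [← lintegral_indicator hmB, ← lintegral_indicator hCo.measurableSet, Set.indicator_indicator,
      Set.inter_eq_right.mpr inter_subset_right]
  rw [step1, step2, step3, step4]

end Comp


/-! ## §3 From the chart identity to `∫ k(s) F(Ψ s) ds = ∫ a F dμ` -/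

section Integral

variable [T2Space G] (μ : Measure G)

/-- **The integral identity the Dixmier–Malliavin road consumes.**  From a chart identity `μ|_{Ψ(C)} = Ψ_*(J · vol|_C)` (`C` open,
`Ψ` continuous and injective on `C` with continuous inverse `σ` on the open set `Ψ(C)`, `J` continuous `> 0` on `C`): for every
continuous `k : ℝ^d → ℂ` with compact support inside `C` there is a continuous compactly supported `a : G → ℂ` supported in `Ψ(C)`
with `∫ k(s) F(Ψ s) ds = ∫ a F dμ` for every continuous `F` — namely `a = (k/J) ∘ σ` on `Ψ(C)`, `0` elsewhere.
[cite: Helgason2000, Ch. I §1 Thm. 1.14 (13) p. 96] [cite: Knapp2002, VIII §2 (8.24)] -/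
theorem exists_integral_eq_integral_mul {C : Set (Fin d → ℝ)} (hCo : IsOpen C) {Ψ : (Fin d → ℝ) → G} {σ : G → (Fin d → ℝ)}
    (hΨc : ContinuousOn Ψ C) (hUo : IsOpen (Ψ '' C)) (hσc : ContinuousOn σ (Ψ '' C)) (hσΨ : ∀ s ∈ C, σ (Ψ s) = s)
    {J : (Fin d → ℝ) → ℝ} (hJ : ContinuousOn J C) (hJ0 : ∀ s ∈ C, 0 < J s)
    (hμ : μ.restrict (Ψ '' C) = Measure.map Ψ ((volume.restrict C).withDensity fun s => ENNReal.ofReal (J s)))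
    (k : (Fin d → ℝ) → ℂ) (hk : Continuous k) (hkc : HasCompactSupport k) (hkC : tsupport k ⊆ C) :
    ∃ a : G → ℂ, Continuous a ∧ HasCompactSupport a ∧ (∀ u, u ∉ Ψ '' C → a u = 0) ∧
      (∀ s ∈ C, a (Ψ s) = k s / (J s : ℂ)) ∧
      ∀ F : G → ℂ, Continuous F → ∫ s, k s * F (Ψ s) = ∫ u, a u * F u ∂μ := by
  set U : Set G := Ψ '' C with hU
  set a : G → ℂ := U.indicator fun u => k (σ u) / (J (σ u) : ℂ) with ha_def
  -- the compact set carrying `a`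
  set K : Set G := Ψ '' tsupport k with hK
  have hKc : IsCompact K := hkc.image_of_continuousOn (hΨc.mono hkC)
  have hKU : K ⊆ U := image_mono hkC
  have haK : ∀ u, u ∉ K → a u = 0 := by
    intro u hu
    by_cases huU : u ∈ U
    · obtain ⟨s, hs, rfl⟩ := huU
      rw [ha_def, indicator_of_mem (mem_image_of_mem Ψ hs), hσΨ s hs]
      have hks : k s = 0 := by
        by_contra hne
        exact hu ⟨s, subset_tsupport _ hne, rfl⟩
      rw [hks, zero_div]
    · rw [ha_def, indicator_of_notMem huU]
  have haσ : ∀ s ∈ C, a (Ψ s) = k s / (J s : ℂ) := fun s hs => by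
    rw [ha_def, indicator_of_mem (mem_image_of_mem Ψ hs), hσΨ s hs]
  -- continuity of `a`: on `U` it is `(k/J) ∘ σ`, off the compact `K ⊆ U` it vanishes
  have hσU : MapsTo σ U C := by
    rintro _ ⟨s, hs, rfl⟩; rw [hσΨ s hs]; exact hs
  have haU : ContinuousOn a U := by
    have h1 : ContinuousOn (fun u => k (σ u) / (J (σ u) : ℂ)) U := by
      refine ContinuousOn.div (hk.comp_continuousOn hσc) ?_ fun u hu => ?_
      · exact Complex.continuous_ofReal.comp_continuousOn (hJ.comp hσc hσU)
      · exact_mod_cast (hJ0 _ (hσU hu)).ne'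
    exact h1.congr fun u hu => by rw [ha_def, indicator_of_mem hu]
  have hac : Continuous a := by
    rw [continuous_iff_continuousAt]
    intro u
    by_cases hu : u ∈ U
    · exact haU.continuousAt (hUo.mem_nhds hu)
    · have huK : u ∉ K := fun h => hu (hKU h)
      have hev : a =ᶠ[𝓝 u] fun _ => 0 := by
        filter_upwards [hKc.isClosed.isOpen_compl.mem_nhds huK] with v hv
        exact haK v hv
      have hau : a u = 0 := haK u huK
      have : Tendsto a (𝓝 u) (𝓝 ((fun _ : G => (0 : ℂ)) u)) := tendsto_const_nhds.congr' hev.symm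
      rw [ContinuousAt, hau]
      exact this
  have hacs : HasCompactSupport a := HasCompactSupport.intro hKc haK
  refine ⟨a, hac, hacs, fun u hu => by rw [ha_def, indicator_of_notMem hu], haσ, fun F hF => ?_⟩
  -- the integral identity
  have hUm : MeasurableSet U := hUo.measurableSet
  have hΨae : AEMeasurable Ψ ((volume.restrict C).withDensity fun s => ENNReal.ofReal (J s)) :=
    (hΨc.aemeasurable hCo.measurableSet).mono_ac (withDensity_absolutelyContinuous _ _)
  have hJae : AEMeasurable (fun s => (J s).toNNReal) (volume.restrict C) :=
    (measurable_real_toNNReal.comp_aemeasurable (hJ.aemeasurable hCo.measurableSet))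
  calc ∫ s, k s * F (Ψ s)
      = ∫ s in C, k s * F (Ψ s) := by
        refine (setIntegral_eq_integral_of_forall_compl_eq_zero fun s hs => ?_).symm
        rw [image_eq_zero_of_notMem_tsupport fun h => hs (hkC h), zero_mul]
    _ = ∫ s in C, (J s).toNNReal • (a (Ψ s) * F (Ψ s)) := by
        refine setIntegral_congr_fun hCo.measurableSet fun s hs => ?_
        have hJs : (J s : ℂ) ≠ 0 := by exact_mod_cast (hJ0 s hs).ne'
        rw [haσ s hs, NNReal.smul_def, Complex.real_smul, Real.coe_toNNReal _ (hJ0 s hs).le]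
        field_simp
    _ = ∫ s, a (Ψ s) * F (Ψ s) ∂((volume.restrict C).withDensity fun s => ENNReal.ofReal (J s)) := by
        rw [show (fun s => ENNReal.ofReal (J s)) = fun s => ((J s).toNNReal : ℝ≥0∞) from rfl,
          integral_withDensity_eq_integral_smul₀ hJae]
    _ = ∫ u, a u * F u ∂(Measure.map Ψ ((volume.restrict C).withDensity fun s => ENNReal.ofReal (J s))) := by
        rw [integral_map hΨae]
        exact ((hac.mul hF).aestronglyMeasurable)
    _ = ∫ u in U, a u * F u ∂μ := by rw [← hμ]
    _ = ∫ u, a u * F u ∂μ := by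
        refine setIntegral_eq_integral_of_forall_compl_eq_zero fun u hu => ?_
        rw [ha_def, indicator_of_notMem hu, zero_mul]

end Integral

end Literature.MeasureTheory.Group.HaarChartReparam

end
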